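import Summits.Ventures.PercRepro.Night2SeriesClassFourCells

/-!
# PercRepro — `(3, 0)` at `|G| = 12` OUTRIGHT, `|G| = 11` with `≤ 4` fat thin closures; residues P (night-2, gen 23)

* `localShadowHall_three_zero_six_of_triangle_pair` (`n = 11` with `≤ 4` closures, `n = 12`): a triangle of
  2-cocircuits `{p, x}, {p, y}` and a further fat thin member whose missed pair is neither `{p, x}`, `{p, y}` nor
  `{x, y}` — the pair is disjoint from the triangle (triangle-plus-disjoint count) or meets it in one point (`K₄`);
* **`localShadowHall_three_zero_six_twelve`**: every `G` with a fat thin member — `≤ 4` closures by the budget cells,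
  `≥ 5`: either two fat missed pairs share a point (→ the triangle and a fourth closure beyond it) or all are
  pairwise disjoint (→ three disjoint);
* **`localShadowHall_three_zero_six_eleven_of_le_four`**: the same dichotomy with four closures (four pairwise
  disjoint → `Night2FourFatCells`);
* **`shadowHall_seven_five_of_residuesP`**: the `(3, 0)` residue of the `(7, 5)` row is the single cell `|G| = 11`
  with `NoFourDisjointFat` and at least FIVE fat thin closures.
-/

namespace PercRepro.Shadow

open Finset PerFlat ThmH

variable {α : Type*} [DecidableEq α]

/-- A 2-subset of a triangle `{p, x, y}` is one of its three pairs. -/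
theorem pair_eq_of_subset_triangle {p x y a z : α} (hpx : p ≠ x) (hpy : p ≠ y) (hxy : x ≠ y) (haz : a ≠ z)
    (ha : a ∈ ({p, x, y} : Finset α)) (hz : z ∈ ({p, x, y} : Finset α)) :
    ({a, z} : Finset α) = {p, x} ∨ ({a, z} : Finset α) = {p, y} ∨ ({a, z} : Finset α) = {x, y} := by
  simp only [Finset.mem_insert, Finset.mem_singleton] at ha hz
  rcases ha with rfl | rfl | rfl <;> rcases hz with rfl | rfl | rfl
  · exact absurd rfl haz
  · exact Or.inl rfl
  · exact Or.inr (Or.inl rfl)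
  · exact Or.inl (Finset.pair_comm _ _)
  · exact absurd rfl haz
  · exact Or.inr (Or.inr rfl)
  · exact Or.inr (Or.inl (Finset.pair_comm _ _))
  · exact Or.inr (Or.inr (Finset.pair_comm _ _))
  · exact absurd rfl haz

variable {M : Matroid α} [M.Finite]

/-- The missed set of a thin member is the complement of its closure in `G`. -/
theorem clF_eq_sdiff_sdiff_of_thin {q : ℕ} {G B : Finset α} (hB : B ∈ thinMembers M q G) :
    clF M B = G \ (G \ clF M B) :=
  (Finset.sdiff_sdiff_eq_self (mem_membersIn.1 (mem_thinMembers.1 hB).1).2).symm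

open scoped Classical in
/-- **A triangle and a further fat thin member close `(3, 0)` at `|G| = 11` (with `≤ 4` fat thin closures) and at
`|G| = 12`**: the further missed pair is disjoint from the triangle or meets it in one point. -/
theorem localShadowHall_three_zero_six_of_triangle_pair {G : Finset α} (hG : G ∈ flatsQ M (5 + 1))
    (hd : (gr M \ G).card = 3) (hk : kColoops M G = 0)
    (hs : ∀ e ∈ gr M, ∀ f ∈ gr M, e ≠ f → rkN M {e, f} = 2) (hl : ∀ e ∈ gr M, M.Indep {e})
    (hn : G.card = 11 ∧ (fatClosures M 5 G 2).card ≤ 4 ∨ G.card = 12)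
    {B₀ B₁ B₂ : Finset α} (hB₀ : B₀ ∈ thinMembers M 5 G) (hB₁ : B₁ ∈ thinMembers M 5 G)
    (hB₂ : B₂ ∈ thinMembers M 5 G) (hfat₂ : (G \ clF M B₂).card ≤ 2)
    {p x y : α} (hP₀ : G \ clF M B₀ = {p, x}) (hP₁ : G \ clF M B₁ = {p, y})
    (hpx : p ≠ x) (hpy : p ≠ y) (hxy : x ≠ y)
    (hQ₀ : G \ clF M B₂ ≠ {p, x}) (hQ₁ : G \ clF M B₂ ≠ {p, y}) (hQ₂ : G \ clF M B₂ ≠ {x, y}) :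
    LocalShadowHall M 5 G := by
  have hd' : (gr M \ G).card ≤ 5 := by omega
  have hpG : p ∈ G := by
    have : p ∈ G \ clF M B₀ := by rw [hP₀]; simp
    exact (Finset.mem_sdiff.1 this).1
  have hxG : x ∈ G := by
    have : x ∈ G \ clF M B₀ := by rw [hP₀]; simp
    exact (Finset.mem_sdiff.1 this).1
  have hyG : y ∈ G := by
    have : y ∈ G \ clF M B₁ := by rw [hP₁]; simp
    exact (Finset.mem_sdiff.1 this).1
  -- the three hyperplanes of the triangle
  have hH₀ : M.eRk ((G \ {p, x} : Finset α) : Set α) ≤ ((5 : ℕ) : ℕ∞) := by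
    have := eRk_clF_le_of_mem_thinMembers hB₀
    rwa [clF_eq_sdiff_sdiff_of_thin hB₀, hP₀] at this
  have hH₁ : M.eRk ((G \ {p, y} : Finset α) : Set α) ≤ ((5 : ℕ) : ℕ∞) := by
    have := eRk_clF_le_of_mem_thinMembers hB₁
    rwa [clF_eq_sdiff_sdiff_of_thin hB₁, hP₁] at this
  have hH₂ : M.eRk ((G \ {x, y} : Finset α) : Set α) ≤ ((5 : ℕ) : ℕ∞) :=
    eRk_sdiff_pair_le_of_series hG hk hH₀ hH₁
      (Finset.sdiff_sdiff_eq_self (Finset.insert_subset hpG (Finset.singleton_subset_iff.2 hxG)))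
      (Finset.sdiff_sdiff_eq_self (Finset.insert_subset hpG (Finset.singleton_subset_iff.2 hyG))) hpx hpy hxy
  have hc₂ : (G \ clF M B₂).card = 2 := le_antisymm hfat₂
    (two_le_card_sdiff_of_not_lay0 hG hd' (mem_thinMembers.1 hB₂).1 (mem_thinMembers.1 hB₂).2)
  by_cases hdisj : (G \ clF M B₂) ∩ {p, x, y} = ∅
  · -- the triangle-plus-disjoint count
    rcases hn with ⟨hn11, hcl⟩ | hn12
    · exact localShadowHall_three_zero_six_eleven_of_triD hG hd hk hs hl hn11 hpx hpy hxy hH₀ hH₁ hH₂ hpG hxG hyG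
        hB₂ hfat₂ hdisj hcl
    · exact localShadowHall_three_zero_six_twelve_of_triD hG hd hk hs hl hn12 hpx hpy hxy hH₀ hH₁ hH₂ hpG hxG hyG
        hB₂ hfat₂ hdisj
  · -- the pair meets the triangle: in exactly one point, the other point `z` is new — a `K₄`
    obtain ⟨a, ha⟩ := Finset.nonempty_iff_ne_empty.2 hdisj
    rw [Finset.mem_inter] at ha
    obtain ⟨u, v, huv, hQ⟩ := Finset.card_eq_two.1 hc₂
    -- write the pair as `{a, z}`
    have hz : ∃ z, G \ clF M B₂ = {a, z} ∧ a ≠ z := by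
      rw [hQ] at ha ⊢
      rcases Finset.mem_insert.1 ha.1 with rfl | h
      · exact ⟨v, rfl, huv⟩
      · rw [Finset.mem_singleton] at h
        subst h
        exact ⟨u, Finset.pair_comm u a, fun h => huv h.symm⟩
    obtain ⟨z, hQz, haz⟩ := hz
    have hzG : z ∈ G := by
      have : z ∈ G \ clF M B₂ := by rw [hQz]; simp
      exact (Finset.mem_sdiff.1 this).1
    have hztri : z ∉ ({p, x, y} : Finset α) := by
      intro hzt
      rcases pair_eq_of_subset_triangle hpx hpy hxy haz ha.2 hzt with h | h | h
      · exact hQ₀ (hQz.trans h)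
      · exact hQ₁ (hQz.trans h)
      · exact hQ₂ (hQz.trans h)
    simp only [Finset.mem_insert, Finset.mem_singleton, not_or] at hztri
    have ha' : a = p ∨ a = x ∨ a = y := by
      have := ha.2
      simp only [Finset.mem_insert, Finset.mem_singleton] at this
      exact this
    have hHa : M.eRk ((G \ {a, z} : Finset α) : Set α) ≤ ((5 : ℕ) : ℕ∞) := by
      have := eRk_clF_le_of_mem_thinMembers hB₂
      rwa [clF_eq_sdiff_sdiff_of_thin hB₂, hQz] at this
    have hsix := sixCocircuits_of_triangle_and_pair hG hk hpx hpy hxy hpG hxG hyG hzG hH₀ hH₁ ha'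
      ⟨hztri.1, hztri.2.1, hztri.2.2⟩ hHa
    rcases hn with ⟨hn11, -⟩ | hn12
    · exact localShadowHall_three_zero_six_eleven_of_K4 hG hd hk hs hl hn11 hpx hpy (Ne.symm hztri.1) hxy
        (Ne.symm hztri.2.1) (Ne.symm hztri.2.2) hsix
    · exact localShadowHall_three_zero_six_twelve_of_K4 hG hd hk hs hl hn12 hpx hpy (Ne.symm hztri.1) hxy
        (Ne.symm hztri.2.1) (Ne.symm hztri.2.2) hsix

open scoped Classical in
/-- With at least four fat thin closures, beyond a triangle `{p, x}, {p, y}` (closures of the thin members `B₀, B₁`)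
there is a fat thin member whose missed pair is none of the three pairs of the triangle. -/
theorem exists_fat_beyond_triangle {G : Finset α} (h4 : 4 ≤ (fatClosures M 5 G 2).card)
    {B₀ B₁ : Finset α} (hB₀ : B₀ ∈ thinMembers M 5 G) (hB₁ : B₁ ∈ thinMembers M 5 G) {p x y : α}
    (hP₀ : G \ clF M B₀ = {p, x}) (hP₁ : G \ clF M B₁ = {p, y}) :
    ∃ B₂ ∈ thinMembers M 5 G, (G \ clF M B₂).card ≤ 2 ∧ G \ clF M B₂ ≠ {p, x} ∧ G \ clF M B₂ ≠ {p, y} ∧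
      G \ clF M B₂ ≠ {x, y} := by
  have hlt : ({clF M B₀, clF M B₁, G \ {x, y}} : Finset (Finset α)).card < (fatClosures M 5 G 2).card :=
    lt_of_le_of_lt Finset.card_le_three (by omega)
  obtain ⟨H, hH, hHn⟩ := Finset.exists_mem_notMem_of_card_lt_card hlt
  unfold fatClosures at hH
  rw [Finset.mem_image] at hH
  obtain ⟨B₂, hB₂, rfl⟩ := hH
  rw [Finset.mem_filter] at hB₂
  simp only [Finset.mem_insert, Finset.mem_singleton, not_or] at hHn
  obtain ⟨hn0, hn1, hn2⟩ := hHn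
  refine ⟨B₂, hB₂.1, hB₂.2, ?_, ?_, ?_⟩
  · intro h; apply hn0
    rw [clF_eq_sdiff_sdiff_of_thin hB₂.1, h, ← hP₀, ← clF_eq_sdiff_sdiff_of_thin hB₀]
  · intro h; apply hn1
    rw [clF_eq_sdiff_sdiff_of_thin hB₂.1, h, ← hP₁, ← clF_eq_sdiff_sdiff_of_thin hB₁]
  · intro h; apply hn2
    rw [clF_eq_sdiff_sdiff_of_thin hB₂.1, h]

open scoped Classical in
/-- **THE CELL `(3, 0)` AT `|G| = 12` CLOSES OUTRIGHT** (given a fat thin member). -/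
theorem localShadowHall_three_zero_six_twelve {G : Finset α} (hG : G ∈ flatsQ M (5 + 1))
    (hd : (gr M \ G).card = 3) (hk : kColoops M G = 0)
    (hs : ∀ e ∈ gr M, ∀ f ∈ gr M, e ≠ f → rkN M {e, f} = 2) (hl : ∀ e ∈ gr M, M.Indep {e})
    (hn : G.card = 12) {B₀ : Finset α} (hB₀ : B₀ ∈ thinMembers M 5 G) (hfat : (G \ clF M B₀).card ≤ 2) :
    LocalShadowHall M 5 G := by
  have hd' : (gr M \ G).card ≤ 5 := by omega
  by_cases h4 : (fatClosures M 5 G 2).card ≤ 4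
  · exact localShadowHall_three_zero_six_twelve_of_le_four hG hd hk hs hl hn hB₀ hfat h4
  push Not at h4
  have hc : ∀ {B : Finset α}, B ∈ thinMembers M 5 G → (G \ clF M B).card ≤ 2 → (G \ clF M B).card = 2 :=
    fun hB hle => le_antisymm hle
      (two_le_card_sdiff_of_not_lay0 hG hd' (mem_thinMembers.1 hB).1 (mem_thinMembers.1 hB).2)
  by_cases hshare : ∃ B₀' ∈ thinMembers M 5 G, ∃ B₁ ∈ thinMembers M 5 G, (G \ clF M B₀').card ≤ 2 ∧
      (G \ clF M B₁).card ≤ 2 ∧ G \ clF M B₀' ≠ G \ clF M B₁ ∧ ((G \ clF M B₀') ∩ (G \ clF M B₁)).Nonempty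
  · obtain ⟨B₀', hB₀', B₁, hB₁, hf₀, hf₁, hne, ⟨p, hp⟩⟩ := hshare
    obtain ⟨x, y, hP₀, hP₁, hpx, hpy, hxy⟩ := pair_shape_of_mem_inter (hc hB₀' hf₀) (hc hB₁ hf₁) hne hp
    obtain ⟨B₂, hB₂, hf₂, hQ₀, hQ₁, hQ₂⟩ := exists_fat_beyond_triangle (by omega) hB₀' hB₁ hP₀ hP₁
    exact localShadowHall_three_zero_six_of_triangle_pair hG hd hk hs hl (Or.inr hn) hB₀' hB₁ hB₂ hf₂ hP₀ hP₁
      hpx hpy hxy hQ₀ hQ₁ hQ₂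
  · push Not at hshare
    obtain ⟨B₀', hB₀', B₁, hB₁, B₂, hB₂, hf₀, hf₁, hf₂, h01, h02, h12⟩ :=
      exists_threeFat_of_two_lt_card_fatClosures (M := M) (q := 5) (G := G) (by omega)
    exact localShadowHall_three_zero_six_twelve_of_threeDisjoint hG hd hk hs hl hn hB₀' hB₁ hB₂ hf₀ hf₁ hf₂
      (hshare B₀' hB₀' B₁ hB₁ hf₀ hf₁ h01) (hshare B₀' hB₀' B₂ hB₂ hf₀ hf₂ h02) (hshare B₁ hB₁ B₂ hB₂ hf₁ hf₂ h12)

open scoped Classical in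
/-- **The cell `(3, 0)` at `|G| = 11` with at most FOUR fat thin closures** (given a fat thin member). -/
theorem localShadowHall_three_zero_six_eleven_of_le_four {G : Finset α} (hG : G ∈ flatsQ M (5 + 1))
    (hd : (gr M \ G).card = 3) (hk : kColoops M G = 0)
    (hs : ∀ e ∈ gr M, ∀ f ∈ gr M, e ≠ f → rkN M {e, f} = 2) (hl : ∀ e ∈ gr M, M.Indep {e})
    (hn : G.card = 11) {B₀ : Finset α} (hB₀ : B₀ ∈ thinMembers M 5 G) (hfat : (G \ clF M B₀).card ≤ 2)
    (hcl : (fatClosures M 5 G 2).card ≤ 4) :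
    LocalShadowHall M 5 G := by
  have hd' : (gr M \ G).card ≤ 5 := by omega
  by_cases h3 : (fatClosures M 5 G 2).card ≤ 3
  · exact localShadowHall_three_zero_six_eleven_of_le_three hG hd hk hs hl hn hB₀ hfat h3
  push Not at h3
  have hc : ∀ {B : Finset α}, B ∈ thinMembers M 5 G → (G \ clF M B).card ≤ 2 → (G \ clF M B).card = 2 :=
    fun hB hle => le_antisymm hle
      (two_le_card_sdiff_of_not_lay0 hG hd' (mem_thinMembers.1 hB).1 (mem_thinMembers.1 hB).2)
  by_cases hshare : ∃ B₀' ∈ thinMembers M 5 G, ∃ B₁ ∈ thinMembers M 5 G, (G \ clF M B₀').card ≤ 2 ∧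
      (G \ clF M B₁).card ≤ 2 ∧ G \ clF M B₀' ≠ G \ clF M B₁ ∧ ((G \ clF M B₀') ∩ (G \ clF M B₁)).Nonempty
  · obtain ⟨B₀', hB₀', B₁, hB₁, hf₀, hf₁, hne, ⟨p, hp⟩⟩ := hshare
    obtain ⟨x, y, hP₀, hP₁, hpx, hpy, hxy⟩ := pair_shape_of_mem_inter (hc hB₀' hf₀) (hc hB₁ hf₁) hne hp
    obtain ⟨B₂, hB₂, hf₂, hQ₀, hQ₁, hQ₂⟩ := exists_fat_beyond_triangle (by omega) hB₀' hB₁ hP₀ hP₁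
    exact localShadowHall_three_zero_six_of_triangle_pair hG hd hk hs hl (Or.inl ⟨hn, hcl⟩) hB₀' hB₁ hB₂ hf₂
      hP₀ hP₁ hpx hpy hxy hQ₀ hQ₁ hQ₂
  · push Not at hshare
    obtain ⟨B₀', hB₀', B₁, hB₁, B₂, hB₂, hf₀, hf₁, hf₂, h01, h02, h12⟩ :=
      exists_threeFat_of_two_lt_card_fatClosures (M := M) (q := 5) (G := G) (by omega)
    -- a fourth fat thin closure
    have hlt : ({clF M B₀', clF M B₁, clF M B₂} : Finset (Finset α)).card < (fatClosures M 5 G 2).card :=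
      lt_of_le_of_lt Finset.card_le_three (by omega)
    obtain ⟨H, hH, hHn⟩ := Finset.exists_mem_notMem_of_card_lt_card hlt
    unfold fatClosures at hH
    rw [Finset.mem_image] at hH
    obtain ⟨B₃, hB₃, rfl⟩ := hH
    rw [Finset.mem_filter] at hB₃
    simp only [Finset.mem_insert, Finset.mem_singleton, not_or] at hHn
    have hne3 : ∀ {B : Finset α}, B ∈ thinMembers M 5 G → clF M B₃ ≠ clF M B → G \ clF M B₃ ≠ G \ clF M B := by
      intro B hB hne h
      apply hne
      rw [clF_eq_sdiff_sdiff_of_thin hB₃.1, h, ← clF_eq_sdiff_sdiff_of_thin hB]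
    exact localShadowHall_three_zero_six_eleven_of_fourDisjoint hG hd hk hs hl hn hB₀' hB₁ hB₂ hB₃.1 hf₀ hf₁ hf₂
      hB₃.2 (hshare B₀' hB₀' B₁ hB₁ hf₀ hf₁ h01) (hshare B₀' hB₀' B₂ hB₂ hf₀ hf₂ h02)
      (hshare B₀' hB₀' B₃ hB₃.1 hf₀ hB₃.2 (Ne.symm (hne3 hB₀' hHn.1)))
      (hshare B₁ hB₁ B₂ hB₂ hf₁ hf₂ h12) (hshare B₁ hB₁ B₃ hB₃.1 hf₁ hB₃.2 (Ne.symm (hne3 hB₁ hHn.2.1)))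
      (hshare B₂ hB₂ B₃ hB₃.1 hf₂ hB₃.2 (Ne.symm (hne3 hB₂ hHn.2.2)))

section SevenFiveP

variable {α' : Type} [DecidableEq α']

/-- **THE `(7, 5)` SHADOW ROW FOR EVERY FINITE MATROID MODULO THE RESIDUES P**: the `(3, 0)` residue is the single cell
`|G| = 11` with `NoFourDisjointFat N G 2` and at least FIVE fat thin closures (the cells `|G| = 10, 12, 13` are closed
outright); `(3, 1)` as in the residues K. -/
theorem shadowHall_seven_five_of_residuesP
    (h20 : ∀ (N : Matroid α') [N.Finite] (G : Finset α'), CellHyp N G →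
      (gr N \ G).card = 2 → kColoops N G = 0 → FatMember N G 6 3 →
      (FatBasis N G 6 2 ∨ FatMember N G 6 2) → LocalShadowHall N 5 G)
    (h21 : ∀ (N : Matroid α') [N.Finite] (G : Finset α'), CellHyp N G →
      (gr N \ G).card = 2 → kColoops N G = 1 → FatMember N G 5 4 →
      (FatBasis N G 5 3 ∨ FatMember N G 5 3) → LocalShadowHall N 5 G)
    (h30 : ∀ (N : Matroid α') [N.Finite] (G : Finset α'), CellHyp N G →
      (gr N \ G).card = 3 → kColoops N G = 0 → G.card = 11 → FatMember N G 6 2 → FatBasis N G 6 2 →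
      NoFourDisjointFat N G 2 → 5 ≤ (fatClosures N 5 G 2).card → LocalShadowHall N 5 G)
    (h31 : ∀ (N : Matroid α') [N.Finite] (G : Finset α'), CellHyp N G →
      (gr N \ G).card = 3 → kColoops N G = 1 → 11 ≤ G.card → G.card ≤ 17 → FatMember N G 5 2 →
      (G.card = 17 → FatBasis N G 5 2) → (G.card = 17 → NestedFat N G 2 3) →
      (G.card = 16 → MeetingFat N G 2) → (11 ≤ G.card ∧ G.card ≤ 17 → NoThreeDisjointFat N G 2) →
      (G.card = 11 ∨ G.card = 15 ∨ G.card = 16 → FatBasis N G 5 3) →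
      (12 ≤ G.card ∧ G.card ≤ 14 → FatBasis N G 5 4) → LocalShadowHall N 5 G)
    (h32 : ∀ (N : Matroid α') [N.Finite] (G : Finset α'), CellHyp N G →
      (gr N \ G).card = 3 → kColoops N G = 2 → FatMember N G 4 2 → LocalShadowHall N 5 G)
    (M : Matroid α') [M.Finite] : ShadowHall M 7 5 (phiK 7 5) := by
  apply shadowHall_seven_five_of_residuesO h20 h21 _ h31 h32
  intro N _ G hcell hd hk h11 h12 hfm hfb hnd3 hnd4 hc11 hc12
  have hfm' := hfm
  obtain ⟨B₀, hB₀, -, hfat⟩ := hfm'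
  by_cases hG12 : G.card = 12
  · exact localShadowHall_three_zero_six_twelve hcell.2.2.2 hd hk hcell.1 hcell.2.1 hG12 hB₀ hfat
  have hG11 : G.card = 11 := by omega
  by_cases hfive : 5 ≤ (fatClosures N 5 G 2).card
  · exact h30 N G hcell hd hk hG11 hfm hfb (hnd4 hG11) hfive
  · push Not at hfive
    exact localShadowHall_three_zero_six_eleven_of_le_four hcell.2.2.2 hd hk hcell.1 hcell.2.1 hG11 hB₀ hfat
      (by omega)

end SevenFiveP

end PercRepro.Shadow
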